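import Mathlib
import Summits.NavierStokesRegularity.NavierStokesRegularity.Theorems.TaoLadderRungTwoBreakOneShiftFrameAssembly
import HarnessLib

/-!
# The one-shift Banach argument on the CLOSED-FORM frame of the STAGE-2 rows

`exists_surviving_dssWave_of_windowCert_v5` (…OneShiftFrameAssembly) still carries the frame "envelopes" as
hypotheses (the tube radii recursion `hrec`, the centre deviations `hdevW/hdevT` and their certificate-side
bound `hdev`, the amplitude envelopes `hAW/hAT/hAtail`, the wake / top tube envelopes `hwakeTube/htopTube`).
For the frame actually used by the STAGE-2/3 certificates these are ARITHMETIC: wake tube centres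
`tubeC i (-n-1) = ĝ^{n+1} c₀ i`, wake tube radii `tubeR (-n-1) = g_hi^{n+1} (r₀ + κ (n+1))`, nothing above the
window (`tubeC i (W+j) = 0`, `tubeR (W+j) = ε_R ϑ_R^j`), amplitudes pinned off the window
(`A (-n-1) = Q β^{n+1}`, `A (W+j) = ε_R ϑ_R^j`), and the centre-deviation allowance
`devC (-j-2) = c_max η ĝ^{j+1}`, `devC (W+j) = 0` where `η` is a hull of `|g - ĝ|` over the admissible set.
`exists_surviving_dssWave_of_windowCert_v6` discharges all of them (the affine-geometric envelope
`affineGeom_le_geom` supplies `β = g_hi (1+δ′)`, `Q ≥ c_max + r₀ + κ/δ′`).  What remains is: the window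
certificate, the window-side Lipschitz numbers in edge form, the hulls `hg0/hg/hη/hA1/hAwin` of the window run,
the closed-form frame equalities (definitional for the concrete frame), scalar rate inequalities, and SEVEN
rows (`hfirstW, hfirstWS, hfirstT, hfirstTS, hrowB, hrowT, hrow1`).  Model lattice only (Tao-type averaged
cascade); nothing here is about Navier–Stokes.
[cite: Tao2016AveragedNS, §4 Lemma 4.1, §5.3–§6; cell vocabulary, harvest/h2-tao-ladder
rung1/KERNEL-STAGE3-PLAN.md §6 (brick 9), rung1/INSTANCE-SHEET-T4-0.1-W76.md (frame table)]
-/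

noncomputable section

namespace Summit.NavierStokesRegularity.NavierStokesRegularity.Theorems

namespace DSSOneShift

open Set MeasureTheory intervalIntegral
open Literature.Analysis.FluidPDE Literature.Analysis.FluidPDE.TaoCascade CertificateGlueOn

variable {m : ℕ}

namespace OneShiftFrame

variable (F : OneShiftFrame m)

/-- **The one-shift Banach argument on the closed-form frame.**  As `exists_surviving_dssWave_of_windowCert_v5`,
with the frame given in CLOSED FORM — wake: `wt (-n-1) = ω θ^{n+1}`, `tubeR (-n-1) = g_hi^{n+1}(r₀ + κ(n+1))`,
`tubeC i (-n-1) = ĝ^{n+1} c₀ i` (`|c₀ i| ≤ c_max`), `A (-n-1) = Q β^{n+1}`; above the window: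
`wt (W+j) = ω_t ϑ^j`, `tubeR (W+j) = ε_R ϑ_R^j`, `tubeC i (W+j) = 0`, `A (W+j) = ε_R ϑ_R^j` — together with the
hull `hη : |g - ĝ| ≤ η` of the renormalisation factor over the admissible set and the scalar conditions
`0 < ĝ ≤ g_hi`, `g_hi (1+δ′) ≤ β` (`1 ≤ β ≤ θ`, `β ≤ Λ`, `β²/Λ ≤ g_hi`), `c_max + r₀ + κ/δ′ ≤ Q`,
`0 < ϑ_R ≤ ϑ ≤ 1`, `ϑ_R Λ < 1`, `A (W-1) ≤ ā_t`, `ε_R ≤ ā_t ϑ_R`.  The envelope hypotheses of `v5`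
(`hAtail, hAW, hAT, hrec, hdevW, hdevT, hdev, hwakeTube, htopTube`) are DERIVED, the centre-deviation allowance
being `devC (-j-2) = c_max η ĝ^{j+1}`, `devC (W+j) = 0`.  Remaining rows: `hfirstW, hfirstWS, hfirstT, hfirstTS`
(first interior rows), `hrowB, hrowT` (boundary contraction rows), `hrow1` (wake-entry self-map row).
Conditional glue for the Tao-type shell model only; nothing about Navier–Stokes.
[cite: Tao2016AveragedNS, §4 Lemma 4.1 (4.8), §5.3–§6; cell vocabulary, harvest/h2-tao-ladder
rung1/KERNEL-STAGE3-PLAN.md §6, rung1/STAGE3-BANACH.md §1–§2, rung1/INSTANCE-SHEET-T4-0.1-W76.md] -/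
theorem exists_surviving_dssWave_of_windowCert_v6 {ε₀ Mα Q β q gHi A1 : ℝ}
    {Z Sb Se γx γb γe dz0 χb χe : ℝ}
    {ω θ κ ωt ϑ abart ϑR εR ghat η cmax r₀ δ' : ℝ} {c₀ : Fin m → ℝ}
    {α : Fin m → Fin m → Fin m → ℤ × ℤ × ℤ → ℝ} (cert : OneShiftWindowCert F ε₀ α)
    (R A vmax χbm χem : ℤ → ℝ)
    (hε : 0 < 1 + ε₀) (hΛ1 : 1 ≤ bigLam ε₀) (hMα : 0 ≤ Mα) (hα : ∀ i₁ i₂ i₃ μ, |α i₁ i₂ i₃ μ| ≤ Mα)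
    (hW1 : 1 ≤ F.W) (hq : 0 ≤ q) (hq1 : q < 1) (hA0 : ∀ k, 0 ≤ A k)
    (hAwin : ∀ w, F.Adm w → ∀ j k', F.InWindow k' → ∀ s ∈ Icc 0 F.τhi, |F.fullFamily cert w j k' s| ≤ A k')
    -- the rate function IS the four-shift bilinear bound
    (hRdef : ∀ k : ℤ, R k = (m : ℝ) ^ 2 * Mα * ((1 + ε₀) ^ ((5 : ℝ) * k / 2) * (A k * A k + 2 * (A k * A (k + 1))) +
        (1 + ε₀) ^ ((5 : ℝ) * ((k : ℝ) - 1) / 2) * (A (k - 1) * A (k - 1))))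
    -- hulls of the renormalisation factor over the admissible set
    (hg0 : ∀ w, F.Adm w → 0 ≤ gfac (slice (F.fullFamily cert w) (F.decodeTau w)) ∧
      gfac (slice (F.fullFamily cert w) (F.decodeTau w)) ≤ gHi)
    (hη : ∀ w, F.Adm w → |gfac (slice (F.fullFamily cert w) (F.decodeTau w)) - ghat| ≤ η)
    (hĝ0 : 0 < ghat) (hĝgHi : ghat ≤ gHi)
    -- window side, EDGE FORM (the engine's STAGE3 lines)
    (hWedge : ∀ u v, F.AdmLip R u → F.AdmLip R v → ∀ B E : ℝ,
      (∀ i, ∀ t ∈ Icc 0 F.τhi, |F.decodeTail u i (-1) t - F.decodeTail v i (-1) t| ≤ B) →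
      (∀ i, ∀ t ∈ Icc 0 F.τhi, |F.decodeTail u i F.W t - F.decodeTail v i F.W t| ≤ E) →
        dist (F.rawWindow cert u) (F.rawWindow cert v) ≤ Z * dist u v + Sb * B + Se * E)
    (hγedge : ∀ u v, F.AdmLip R u → F.AdmLip R v → ∀ B E : ℝ,
      (∀ i, ∀ t ∈ Icc 0 F.τhi, |F.decodeTail u i (-1) t - F.decodeTail v i (-1) t| ≤ B) →
      (∀ i, ∀ t ∈ Icc 0 F.τhi, |F.decodeTail u i F.W t - F.decodeTail v i F.W t| ≤ E) →
        |gfac (slice (F.fullFamily cert u) (F.decodeTau u)) -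
          gfac (slice (F.fullFamily cert v) (F.decodeTau v))| ≤ γx * dist u v + γb * B + γe * E)
    (hZedge : ∀ u v, F.AdmLip R u → F.AdmLip R v → ∀ i, ∀ B E : ℝ,
      (∀ i, ∀ t ∈ Icc 0 F.τhi, |F.decodeTail u i (-1) t - F.decodeTail v i (-1) t| ≤ B) →
      (∀ i, ∀ t ∈ Icc 0 F.τhi, |F.decodeTail u i F.W t - F.decodeTail v i F.W t| ≤ E) →
        |F.fullFamily cert u i 0 (F.decodeTau u) - F.fullFamily cert v i 0 (F.decodeTau v)| ≤
          dz0 * dist u v + χb * B + χe * E)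
    (hDedge : ∀ u v, F.AdmLip R u → F.AdmLip R v → ∀ j k', F.InWindow k' → ∀ s ∈ Icc 0 F.τhi, ∀ B E : ℝ,
      (∀ i, ∀ t ∈ Icc 0 F.τhi, |F.decodeTail u i (-1) t - F.decodeTail v i (-1) t| ≤ B) →
      (∀ i, ∀ t ∈ Icc 0 F.τhi, |F.decodeTail u i F.W t - F.decodeTail v i F.W t| ≤ E) →
        |F.fullFamily cert u j k' s - F.fullFamily cert v j k' s| ≤ vmax k' * dist u v + χbm k' * B + χem k' * E)
    (hqX : Z + Sb * F.wt (-1) + Se * F.wt F.W ≤ q)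
    (hDwin0 : ∀ k', F.InWindow k' → 0 ≤ vmax k' + χbm k' * F.wt (-1) + χem k' * F.wt F.W)
    (hγ0 : 0 ≤ γx + γb * F.wt (-1) + γe * F.wt F.W)
    -- the closed-form frame: wake side
    (hθ : 1 ≤ θ) (hβ1 : 1 ≤ β) (hβθ : β ≤ θ) (hβΛ : β ≤ bigLam ε₀) (hω : 0 ≤ ω)
    (hδ' : 0 < δ') (hβge : gHi * (1 + δ') ≤ β) (hr₀ : 0 ≤ r₀) (hκ : 0 ≤ κ) (hc : ∀ i, |c₀ i| ≤ cmax)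
    (hQ : cmax + r₀ + κ / δ' ≤ Q) (hσξ : β ^ 2 * (bigLam ε₀)⁻¹ ≤ gHi)
    (hwtW : ∀ n : ℕ, F.wt (-(n : ℤ) - 1) = ω * θ ^ (n + 1))
    (htubeRW : ∀ n : ℕ, F.tubeR (-(n : ℤ) - 1) = gHi ^ (n + 1) * (r₀ + κ * ((n : ℝ) + 1)))
    (htubeCW : ∀ i (n : ℕ), F.tubeC i (-(n : ℤ) - 1) = ghat ^ (n + 1) * c₀ i)
    (hAW : ∀ n : ℕ, A (-(n : ℤ) - 1) = Q * β ^ (n + 1))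
    -- the closed-form frame: above the window
    (hϑ0 : 0 < ϑ) (hϑ1 : ϑ ≤ 1) (hϑR : 0 < ϑR) (hϑRϑ : ϑR ≤ ϑ) (hϑRΛ : ϑR * bigLam ε₀ < 1) (hωt : 0 ≤ ωt)
    (hAlast : A ((F.W : ℤ) - 1) ≤ abart) (hεab : εR ≤ abart * ϑR)
    (hwtT : ∀ j : ℕ, F.wt ((F.W : ℤ) + j) = ωt * ϑ ^ j)
    (htubeRT : ∀ j : ℕ, F.tubeR ((F.W : ℤ) + j) = εR * ϑR ^ j)
    (htubeCT : ∀ i (j : ℕ), F.tubeC i ((F.W : ℤ) + j) = 0)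
    (hAT : ∀ j : ℕ, A ((F.W : ℤ) + j) = εR * ϑR ^ j)
    -- the seven rows
    (hfirstW : ∀ i, gHi * (ω * θ + (4 * (m : ℝ) ^ 2 * Mα * Q ^ 2 * β ^ 2) * (β ^ 2 * (bigLam ε₀)⁻¹) * F.rτ) +
      Q * β * (γx + γb * F.wt (-1) + γe * F.wt F.W) +
      F.τhi * (2 * tableAbsSum α i * (bigLam ε₀)⁻¹ ^ 2 * (ω * θ ^ 3) * (Q * β ^ 3)) ≤ q * (ω * θ ^ 2))
    (hfirstWS : cmax * η * ghat +
      F.τhi * ((4 * (m : ℝ) ^ 2 * Mα * Q ^ 2 * β ^ 2) * (β ^ 2 * (bigLam ε₀)⁻¹) ^ 2) ≤ κ * gHi ^ 2)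
    (hfirstT : ∀ i, gHi * (ωt * ϑ ^ 2 +
        (4 * (m : ℝ) ^ 2 * Mα * abart ^ 2 * bigLam ε₀ ^ F.W) * (bigLam ε₀ * ϑR ^ 2) ^ 2 * F.rτ) +
      (abart * ϑR) * ϑR ^ 2 * (γx + γb * F.wt (-1) + γe * F.wt F.W) +
      F.τhi * (2 * tableAbsSum α i * bigLam ε₀ ^ (F.W + 1) * ωt * (abart * ϑR)) ≤ q * (ωt * ϑ))
    (hfirstTS : gHi * (εR * ϑR) + F.τhi * (4 * (m : ℝ) ^ 2 * Mα * abart ^ 2 * bigLam ε₀ ^ F.W) ≤ εR)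
    (hrowB : ∀ i, gHi * (dz0 + χb * F.wt (-1) + χe * F.wt F.W) + A 0 * (γx + γb * F.wt (-1) + γe * F.wt F.W) +
      F.τhi * quadTermLip ε₀ α A
        (fun k' => if F.InWindow k' then vmax k' + χbm k' * F.wt (-1) + χem k' * F.wt F.W else F.wt k') i (-1) ≤
        q * F.wt (-1))
    (hrowT : ∀ i, gHi * (F.wt ((F.W : ℤ) + 1) + R ((F.W : ℤ) + 1) * F.rτ) +
      A ((F.W : ℤ) + 1) * (γx + γb * F.wt (-1) + γe * F.wt F.W) +
      F.τhi * quadTermLip ε₀ α A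
        (fun k' => if F.InWindow k' then vmax k' + χbm k' * F.wt (-1) + χem k' * F.wt F.W else F.wt k') i F.W ≤
        q * F.wt F.W)
    (hrow1 : A1 + F.τhi * R (-1) ≤ F.tubeR (-1))
    -- the rest as in `v4` / `v5`
    (h0 : ∃ u, F.AdmLip R u)
    (hwinIn : ∀ u, F.AdmLip R u →
      (∀ i k, |(F.rawWindow cert u).1 i k| ≤ 1) ∧ |(F.rawWindow cert u).2| ≤ 1)
    (hA1 : ∀ w, F.Adm w → ∀ i,
      |gfac (slice (F.fullFamily cert w) (F.decodeTau w)) * F.fullFamily cert w i 0 (F.decodeTau w) -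
        F.tubeC i (-1)| ≤ A1)
    (hg : ∀ u, F.AdmLip R u →
      1 < gfac (slice (F.fullFamily cert u) (F.decodeTau u)) ^ 2 ∧
        gfac (slice (F.fullFamily cert u) (F.decodeTau u)) ^ 2 ≤ 1 + ε₀ ∧
        gfac (slice (F.fullFamily cert u) (F.decodeTau u)) < bigLam ε₀ ∧
        β ^ 2 < gfac (slice (F.fullFamily cert u) (F.decodeTau u)) * bigLam ε₀)
    (hQA : A 0 ≤ Q) (hne : ∃ i, F.a i 0 < |F.yc i 0|) :
    ∃ (T : ℝ) (Φ : Unit → ℝ → Em m), 0 < T ∧ IsDSSWave ε₀ α (Equiv.refl Unit) T Φ ∧ Surviving 1 ε₀ T ∧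
      ∃ x, Φ () x ≠ 0 := by
  -- signs of the frame constants
  obtain ⟨i₀, -⟩ := id hne
  have hcmax : 0 ≤ cmax := (abs_nonneg _).trans (hc i₀)
  have hgHi : 0 ≤ gHi := hĝ0.le.trans hĝgHi
  have hη0 : 0 ≤ η := by
    obtain ⟨u₀, hu₀⟩ := h0
    exact (abs_nonneg _).trans (hη u₀ hu₀.1)
  have habar : 0 ≤ Q := le_trans (by positivity : 0 ≤ cmax + r₀ + κ / δ') hQ
  have habart : 0 ≤ abart := (hA0 _).trans hAlast
  have hεR : 0 ≤ εR := by
    have h := F.tubeR_nonneg ((F.W : ℤ) + (0 : ℕ))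
    rw [htubeRT 0] at h
    simpa using h
  have hβ0 : 0 ≤ β := by linarith
  have hgβ : gHi ≤ β := le_trans (le_mul_of_one_le_right hgHi (by linarith)) hβge
  have hĝβ : ghat ≤ β := hĝgHi.trans hgβ
  have hdbar : 0 ≤ cmax * η / ghat := by positivity
  have hC₀ : 0 ≤ εR / ϑR ^ F.W := by positivity
  have hΛϑ : bigLam ε₀ * ϑR ≤ 1 := by rw [mul_comm]; exact hϑRΛ.le
  -- the centre-deviation allowance
  obtain ⟨devC, hdevC⟩ : ∃ devC : ℤ → ℝ,
      devC = fun k => if k < 0 then cmax * η * ghat ^ (-k - 1).toNat else 0 := ⟨_, rfl⟩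
  -- the wake tube envelope (affine-geometric ≤ geometric)
  have hwake : ∀ i (n : ℕ), |F.tubeC i (-(n : ℤ) - 1)| + F.tubeR (-(n : ℤ) - 1) ≤ Q * β ^ (n + 1) := by
    intro i n
    rw [htubeCW, htubeRW, abs_mul, abs_of_nonneg (pow_nonneg hĝ0.le _)]
    have h1 : ghat ^ (n + 1) * |c₀ i| ≤ β ^ (n + 1) * cmax :=
      mul_le_mul (pow_le_pow_left₀ hĝ0.le hĝβ _) (hc i) (abs_nonneg _) (pow_nonneg hβ0 _)
    have h2 : gHi ^ (n + 1) * (r₀ + κ * ((n : ℝ) + 1)) ≤ (r₀ + κ / δ') * β ^ (n + 1) := by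
      have h := affineGeom_le_geom hr₀ hκ hgHi hδ' (n + 1)
      push_cast at h
      calc gHi ^ (n + 1) * (r₀ + κ * ((n : ℝ) + 1)) = (r₀ + κ * ((n : ℝ) + 1)) * gHi ^ (n + 1) := by ring
        _ ≤ (r₀ + κ / δ') * (gHi * (1 + δ')) ^ (n + 1) := h
        _ ≤ (r₀ + κ / δ') * β ^ (n + 1) :=
          mul_le_mul_of_nonneg_left (pow_le_pow_left₀ (by positivity) hβge _) (by positivity)
    calc ghat ^ (n + 1) * |c₀ i| + gHi ^ (n + 1) * (r₀ + κ * ((n : ℝ) + 1))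
        ≤ β ^ (n + 1) * cmax + (r₀ + κ / δ') * β ^ (n + 1) := add_le_add h1 h2
      _ = (cmax + r₀ + κ / δ') * β ^ (n + 1) := by ring
      _ ≤ Q * β ^ (n + 1) := mul_le_mul_of_nonneg_right hQ (pow_nonneg hβ0 _)
  -- the envelope hypotheses of `v5`, derived
  have hAtail : ∀ j k', ¬ F.InWindow k' → |F.tubeC j k'| + F.tubeR k' ≤ A k' := by
    intro j k' hk'
    unfold InWindow at hk'
    rcases lt_or_ge k' 0 with h | h
    · obtain ⟨n, rfl⟩ : ∃ n : ℕ, k' = -(n : ℤ) - 1 := ⟨(-k' - 1).toNat, by omega⟩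
      rw [hAW n]
      exact hwake j n
    · obtain ⟨n, rfl⟩ : ∃ n : ℕ, k' = (F.W : ℤ) + n := ⟨(k' - F.W).toNat, by omega⟩
      rw [htubeCT, htubeRT, hAT, abs_zero, zero_add]
  have hAW' : ∀ j : ℕ, A (-(j : ℤ)) ≤ Q * β ^ j := by
    intro j
    cases j with
    | zero => simpa using hQA
    | succ n =>
      have e : (-((n + 1 : ℕ) : ℤ)) = -(n : ℤ) - 1 := by push_cast; ring
      rw [e, hAW n]
  have hAT' : ∀ j : ℕ, A ((F.W : ℤ) - 1 + j) ≤ abart * ϑR ^ j := by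
    intro j
    cases j with
    | zero => simpa using hAlast
    | succ n =>
      have e : (F.W : ℤ) - 1 + ((n + 1 : ℕ) : ℤ) = (F.W : ℤ) + n := by push_cast; ring
      rw [e, hAT n]
      calc εR * ϑR ^ n ≤ abart * ϑR * ϑR ^ n := mul_le_mul_of_nonneg_right hεab (pow_nonneg hϑR.le _)
        _ = abart * ϑR ^ (n + 1) := by ring
  have hrec : ∀ j : ℕ, gHi * F.tubeR (-(j : ℤ) - 1) + κ * gHi ^ (j + 2) ≤ F.tubeR (-(j : ℤ) - 2) := by
    intro j
    have e : (-(j : ℤ) - 2) = -((j + 1 : ℕ) : ℤ) - 1 := by push_cast; ring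
    rw [e, htubeRW j, htubeRW (j + 1)]
    push_cast
    exact le_of_eq (by ring)
  have hdevW : ∀ j : ℕ, devC (-(j : ℤ) - 2) ≤ cmax * η / ghat * ghat ^ (j + 2) := by
    intro j
    have e : (-(-(j : ℤ) - 2) - 1).toNat = j + 1 := by omega
    rw [hdevC]
    simp only
    rw [if_pos (by omega), e]
    exact le_of_eq (by field_simp; ring)
  have hdevT : ∀ j : ℕ, devC ((F.W : ℤ) + j) ≤ 0 := by
    intro j
    rw [hdevC]
    simp only
    rw [if_neg (by omega)]
  have hdev : ∀ w, F.Adm w → ∀ i k, ¬ F.InWindow k → ¬ F.InWindow (k + 1) →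
      |gfac (slice (F.fullFamily cert w) (F.decodeTau w)) * F.tubeC i (k + 1) - F.tubeC i k| ≤ devC k := by
    intro w hw i k hk hk1
    rcases F.tail_index_cases₂ hW1 hk hk1 with ⟨j, rfl⟩ | ⟨j, rfl⟩
    · have e1 : (-(j : ℤ) - 2 + 1) = -(j : ℤ) - 1 := by ring
      have e2 : (-(j : ℤ) - 2) = -((j + 1 : ℕ) : ℤ) - 1 := by push_cast; ring
      have e3 : (-(-(j : ℤ) - 2) - 1).toNat = j + 1 := by omega
      rw [e1, htubeCW i j, hdevC]
      simp only
      rw [if_pos (by omega), e3, e2, htubeCW i (j + 1)]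
      have e4 : gfac (slice (F.fullFamily cert w) (F.decodeTau w)) * (ghat ^ (j + 1) * c₀ i) -
          ghat ^ (j + 1 + 1) * c₀ i =
          ghat ^ (j + 1) * ((gfac (slice (F.fullFamily cert w) (F.decodeTau w)) - ghat) * c₀ i) := by ring
      rw [e4, abs_mul, abs_of_nonneg (pow_nonneg hĝ0.le _), abs_mul]
      calc ghat ^ (j + 1) * (|gfac (slice (F.fullFamily cert w) (F.decodeTau w)) - ghat| * |c₀ i|)
          ≤ ghat ^ (j + 1) * (η * cmax) :=
            mul_le_mul_of_nonneg_left (mul_le_mul (hη w hw) (hc i) (abs_nonneg _) hη0) (pow_nonneg hĝ0.le _)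
        _ = cmax * η * ghat ^ (j + 1) := by ring
    · have e1 : ((F.W : ℤ) + j + 1) = (F.W : ℤ) + ((j + 1 : ℕ) : ℤ) := by push_cast; ring
      rw [e1, htubeCT, htubeCT, hdevC]
      simp only
      rw [if_neg (by omega)]
      simp
  have hwakeTube : ∀ i (n : ℕ), 1 ≤ n → |F.tubeC i (-(n : ℤ))| + F.tubeR (-(n : ℤ)) ≤ Q * β ^ n := by
    intro i n hn
    obtain ⟨n', rfl⟩ : ∃ n', n = n' + 1 := ⟨n - 1, by omega⟩
    have e : (-((n' + 1 : ℕ) : ℤ)) = -(n' : ℤ) - 1 := by push_cast; ring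
    rw [e]
    exact hwake i n'
  have htopTube : ∀ i (j : ℕ), |F.tubeC i ((F.W : ℤ) + j)| + F.tubeR ((F.W : ℤ) + j) ≤
      εR / ϑR ^ F.W * ϑR ^ (F.W + j) := by
    intro i j
    have hne' : ϑR ^ F.W ≠ 0 := pow_ne_zero _ hϑR.ne'
    rw [htubeCT, htubeRT, abs_zero, zero_add, pow_add, ← mul_assoc, div_mul_cancel₀ _ hne']
  have hfirstWS' : cmax * η / ghat * ghat ^ 2 +
      F.τhi * ((4 * (m : ℝ) ^ 2 * Mα * Q ^ 2 * β ^ 2) * (β ^ 2 * (bigLam ε₀)⁻¹) ^ 2) ≤ κ * gHi ^ 2 := by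
    have e : cmax * η / ghat * ghat ^ 2 = cmax * η * ghat := by field_simp
    rw [e]
    exact hfirstWS
  exact F.exists_surviving_dssWave_of_windowCert_v5 cert R A devC vmax χbm χem hε hΛ1 hMα hα hW1 hq hq1 hA0
    hAtail hAwin hRdef hg0 hWedge hγedge hZedge hDedge hqX hDwin0 hγ0
    hθ hβ1 hβθ hβΛ hω habar hwtW hAW' hgHi hĝ0.le hĝgHi hσξ hdbar hrec hdevW
    hϑ0 hϑ1 hϑR hϑRϑ hΛϑ hωt habart hwtT hAT' hϑR le_rfl htubeRT hdevT
    hfirstW hfirstWS' hfirstT hfirstTS hrowB hrowT hrow1 h0 hwinIn hdev hA1 hg hQA hwakeTube hϑR hϑRΛ hC₀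
    htopTube hne

end OneShiftFrame

end DSSOneShift

end Summit.NavierStokesRegularity.NavierStokesRegularity.Theorems
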